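import Mathlib
import Literature.NumberTheory.LFunctions.Zhang2022.GaussKernelContour
import Literature.NumberTheory.LFunctions.Zhang2022.Section8Lemma84PhiBounds
import Literature.NumberTheory.LFunctions.Zhang2022.Section8Lemma84Poles
import HarnessLib

/-!
# Zhang (2022) §12 u030, contour step: the Gaussian-smoothed `ξ_j`-series as the two residues plus a
# Landau-rectangle remainder (the "Mellin transform + move the contour as in Lemma 8.4" step)

Topic `Literature/NumberTheory/LFunctions/Zhang2022` (Landau–Siegel audit tree; verdict-neutral).
Y. Zhang, *Discrete mean estimates and the Landau–Siegel zero*, arXiv:2211.02515v1 (2022)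
[Zhang2022LandauSiegel] — **an unrefereed manuscript under adjudication**; ZHANG-L lane WP12, helper
under the RT-02 node hTop25Ex (core `Typed.Sec12B.U030`, §12 p.70: "In a way similar to the proof of
Lemma 12.1 [12.2] we deduce …", i.e. p.69 u024–u025: smooth by `g`, Mellin transform, "In a way similar
to the proof of Lemma 8.4 … move the contour"). Nothing here asserts or denies Theorems 1–2.

This file is the kernel-generic CONTOUR CORE, in the style of the tree's `Lemma84.lemma84_core`
(`Section8Lemma84Estimate`) but for the GAUSSIAN Perron kernel of §4 (4.1) with a real shift `θ`
(`K(u) = Y^{u+θ}ω₁(u+θ)/(u+θ)`, `GaussKernelContour`): for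
`Φ(u) = U(1−β_μ+u)·L(1−β_μ+u+β_a)L(1−β_μ+u+β_b)/L(1−β_μ+u,χ)` (`Re β_μ = 0`, `0 < Im β_μ`,
`‖β_μ‖ ≤ 1/2`; `U` = the continuation `𝒰_j(d,r;·)` of Lemma 8.3 with the hypotheses of
`Skeleton.Lemma83Rel`), a coefficient sequence `f` whose `L`-series is `Φ` on `Re u = 1`, and the
zero-free/size package of `Lemma84.exceptional_package`:

  `‖Σ_n f(n)n^{−(1−β_μ−θ)}g_Λ(Y/n) − (Φ(−θ) + r·K(u₁))‖ ≤ (1/2π)(tails + left + 2·horizontal)`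

(`smoothedSeries_sub_residues_le`), where `u₁ = ρ̃ − 1 + β_μ` is the pole coming from the exceptional
zero, `r = U(ρ̃)L(ρ̃+β_a)L(ρ̃+β_b)/L′(ρ̃,χ)` its residue coefficient, and the three remainder pieces are
those of `GaussKernelContour.norm_lineIntegral_sub_sum_limUnder_le` with `M₀ = 27M_U`,
`M₁ = M_UB_L²M_inv(1+2/η)`, `M₂ = 3M_UB_L²M_inv` (`Lemma84.norm_Phi_right/left/horiz_le`). The
Perron identity is the tree's `GaussWeight.integral_LSeries_mul_kernel`.

For `U030` one takes `β_μ := β₆ − i·Im w`, `θ := −Re w` (so `1−β_μ−θ = 1−β₆+w`), `Y = P″₂/dr`,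
`f(n) = χ(n)ξ₀ⱼ(n;d,r)`; the sizes of the residues and of the remainder are the assembly file's.

## References

* Y. Zhang, arXiv:2211.02515v1 (2022), §12 pp.69–70 (u024–u025, proof of Lemma 12.3); §8 proof of
  Lemma 8.4 p.47; §4 (4.1). [cite: Zhang2022LandauSiegel, §12 pp.69–70; §8 Lemma 8.4]
* H. L. Montgomery, R. C. Vaughan, *Multiplicative Number Theory I*, CUP 2007, §5.1, §6.2, Thm 11.4.
  [cite: MontgomeryVaughan2007, §6.2]
-/

noncomputable section

open Complex Real Filter Topology Set MeasureTheory

namespace Literature.NumberTheory.LFunctions.Zhang2022.Lemma84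

open GaussWeight GaussKernelContour

section Contour

variable {D : ℕ} [NeZero D] (χ : DirichletCharacter ℂ D)
variable (U Φ : ℂ → ℂ) (βμ βa βb : ℂ) {ρ η T' MU BL Minv : ℝ}

/-- An entire function vanishing at `a` factors as `(u − a)·ψ(u)` with `ψ` entire, `ψ(a) = f′(a)`
(`ψ = dslope f a`; as in `Section8Lemma84Poles`). [cite: Conway1978, Ch. IV Cor. 3.9] -/
private theorem exists_factor_of_zero' (f : ℂ → ℂ) (hf : Differentiable ℂ f) (a : ℂ)
    (hfa : f a = 0) :
    ∃ ψ : ℂ → ℂ, Differentiable ℂ ψ ∧ ψ a = deriv f a ∧ ∀ u, f u = (u - a) * ψ u := by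
  refine ⟨dslope f a, ?_, dslope_same f a, fun u => ?_⟩
  · have h : DifferentiableOn ℂ (dslope f a) Set.univ := by
      rw [differentiableOn_dslope (Filter.univ_mem)]
      exact hf.differentiableOn
    exact fun u => h.differentiableAt (Filter.univ_mem)
  · have h := sub_smul_dslope f a u
    rw [smul_eq_mul, hfa, sub_zero] at h
    exact h.symm

/-- **The contour core of u030 (and of u025)**: the Gaussian-smoothed Dirichlet series equals the
residue at the kernel's pole `u = −θ` plus the residue at the exceptional-zero pole `u₁ = ρ̃−1+β_μ`, up
to the Landau-rectangle remainder `(1/2π)(tails + left + 2·horizontal)` with `M₀ = 27M_U`,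
`M₁ = M_UB_L²M_inv(1+2/η)`, `M₂ = 3M_UB_L²M_inv`, rectangle `[−η, 1] × [−T′, T′]`, kernel
`Y^{u+θ}ω₁(u+θ)/(u+θ)` (`|θ| ≤ η/4`). Hypotheses as in `Lemma84.lemma84_core`.
[cite: Zhang2022LandauSiegel, §12 p.70 (proof of Lemma 12.3); §8 Lemma 8.4 (proof)]
[cite: MontgomeryVaughan2007, §6.2] -/
theorem smoothedSeries_sub_residues_le (hχ1 : χ ≠ 1) {Λ Y θ : ℝ} (hΛ : 0 < Λ) (hY : 0 < Y)
    (hUd : DifferentiableOn ℂ U {s : ℂ | 9 / 10 < s.re})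
    (hβμ : βμ.re = 0) (hβμim : 0 < βμ.im) (hβμn : ‖βμ‖ ≤ 1 / 2)
    (hβa : βa.re = 0) (hβa1 : ‖βa‖ ≤ 1) (hβb : βb.re = 0) (hβb1 : ‖βb‖ ≤ 1)
    (hΦ : ∀ u, Φ u = U (1 - βμ + u) * χ.LFunction (1 - βμ + u + βa) *
      χ.LFunction (1 - βμ + u + βb) / χ.LFunction (1 - βμ + u))
    (hη0 : 0 < η) (hη40 : η ≤ 1 / 40) (hθ : |θ| ≤ η / 4) (hT : 2 ≤ T') (hTβ : βμ.im < T')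
    (hMU : 0 ≤ MU) (hU : ∀ w : ℂ, 1 - η ≤ w.re → ‖U w‖ ≤ MU) (hBL : 0 ≤ BL)
    (hL : ∀ s : ℂ, 1 - η ≤ s.re → ‖s‖ ≤ T' + 4 → ‖χ.LFunction s‖ ≤ BL) (hMinv : 0 ≤ Minv)
    (hpack : ∀ s : ℂ, 1 - 2 * η ≤ s.re → |s.im| ≤ T' + 1 → s ≠ (ρ : ℂ) →
      χ.LFunction s ≠ 0 ∧ ‖(χ.LFunction s)⁻¹‖ ≤ Minv * (1 + ‖s - ρ‖⁻¹))
    (hρ1 : ρ < 1) (hρη : 1 - η / 2 ≤ ρ) (hLρ : χ.LFunction ρ = 0) (hL'ρ : deriv χ.LFunction ρ ≠ 0)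
    (f : ℕ → ℂ) (hfs : LSeriesSummable f (2 - βμ))
    (hfΦ : ∀ t : ℝ, LSeries f (1 - βμ + ((1 : ℝ) + t * I)) = Φ ((1 : ℝ) + t * I)) :
    ‖(∑' n : ℕ, LSeries.term f (1 - βμ - θ) n * (gWeight Λ (Y / n) : ℂ)) -
        (Φ (-(θ : ℂ)) +
          U ρ * χ.LFunction (ρ + βa) * χ.LFunction (ρ + βb) / deriv χ.LFunction ρ *
            ((Y : ℂ) ^ ((((ρ - 1 : ℝ) : ℂ) + βμ) + θ) * omega1 Λ ((((ρ - 1 : ℝ) : ℂ) + βμ) + θ) /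
              ((((ρ - 1 : ℝ) : ℂ) + βμ) + θ)))‖ ≤
      1 / (2 * π) *
        (2 * ((MU * ((1 + 1 / 2) / (1 / 2)) ^ 3) *
              (Y ^ (1 + θ) * rexp ((1 + θ) ^ 2 / (4 * Λ)) / |1 + θ|) *
            (gauss (4 * Λ)⁻¹ T' * (Real.sqrt (4 * π * Λ) / 2))) +
          (MU * BL * BL * (Minv * (1 + 2 / η))) *
              (Y ^ (-η + θ) * rexp ((-η + θ) ^ 2 / (4 * Λ)) / |(-η) + θ|) * Real.sqrt (4 * π * Λ) +
          2 * ((1 - (-η)) * ((MU * BL * BL * (Minv * 3)) *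
              (max (Y ^ (-η + θ)) (Y ^ (1 + θ)) *
                rexp (max ((-η + θ) ^ 2) ((1 + θ) ^ 2) / (4 * Λ)) *
                gauss (4 * Λ)⁻¹ T' / T')))) := by
  classical
  -- sizes
  have hθη : |θ| < η := by linarith [abs_nonneg θ]
  have hθ1 : |θ| ≤ 1 / 160 := by linarith
  have hθb := abs_le.mp hθ
  -- the pole `u₁ = ρ̃ − 1 + β_μ`
  set u₁ : ℂ := ((ρ - 1 : ℝ) : ℂ) + βμ with hu₁
  have hu₁re : u₁.re = ρ - 1 := by simp [hu₁, hβμ]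
  have hu₁im : u₁.im = βμ.im := by simp [hu₁]
  have hw₁ : 1 - βμ + u₁ = ρ := by rw [hu₁]; push_cast; ring
  have hβre : ((θ : ℂ)).re = θ := Complex.ofReal_re θ
  have hβim : ((θ : ℂ)).im = 0 := Complex.ofReal_im θ
  have hu₁θ : u₁ + (θ : ℂ) ≠ 0 := by
    intro h; have := congrArg Complex.im h; simp [hu₁im] at this; linarith
  have hneq : (-(θ : ℂ)) ≠ u₁ := by
    intro h; have := congrArg Complex.im h; simp [hu₁im] at this; linarith
  -- the zero-free box (strict form) and the non-vanishing of `L(1−β_μ+u)`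
  have hzf : ∀ w : ℂ, 1 - 2 * η ≤ w.re → |w.im| ≤ T' + 1 → w ≠ (ρ : ℂ) → χ.LFunction w ≠ 0 :=
    fun w h1 h2 h3 => (hpack w h1 h2 h3).1
  have hLne : ∀ u : ℂ, -(2 * η) ≤ u.re → |u.im| ≤ T' + 1 / 2 → u ≠ u₁ →
      χ.LFunction (1 - βμ + u) ≠ 0 := fun u h1 h2 h3 =>
    LFunction_ne_zero_near χ βμ (ρ := ρ) (η := η) (T' := T') hβμ hβμn hzf h1 h2 h3
  -- the open neighbourhood of the rectangle
  set Uo : Set ℂ := {u : ℂ | -(2 * η) < u.re ∧ u.re < 3 / 2 ∧ |u.im| < T' + 1 / 2} with hUo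
  have hUo_open : IsOpen Uo := by
    have h1 : IsOpen {u : ℂ | -(2 * η) < u.re} := isOpen_lt continuous_const Complex.continuous_re
    have h2 : IsOpen {u : ℂ | u.re < 3 / 2} := isOpen_lt Complex.continuous_re continuous_const
    have h3 : IsOpen {u : ℂ | |u.im| < T' + 1 / 2} :=
      isOpen_lt (continuous_abs.comp Complex.continuous_im) continuous_const
    have : Uo = {u : ℂ | -(2 * η) < u.re} ∩ ({u : ℂ | u.re < 3 / 2} ∩ {u : ℂ | |u.im| < T' + 1 / 2}) := by
      ext u; rfl
    rw [this]; exact h1.inter (h2.inter h3)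
  have hKU : Icc (-η) 1 ×ℂ Icc (-T') T' ⊆ Uo := by
    intro u hu
    rw [mem_reProdIm, mem_Icc, mem_Icc] at hu
    refine ⟨by linarith [hu.1.1], by linarith [hu.1.2], ?_⟩
    rw [abs_lt]; constructor <;> linarith [hu.2.1, hu.2.2]
  -- `Φ` is differentiable on `Uo ∖ {u₁}`
  have hΦdiff : ∀ u ∈ Uo, u ≠ u₁ → DifferentiableAt ℂ Φ u := by
    intro u hu hne
    have hu' : -(2 * η) < u.re ∧ u.re < 3 / 2 ∧ |u.im| < T' + 1 / 2 := hu
    exact differentiableAt_Phi χ U Φ βμ βa βb hχ1 hUd hβμ hΦ (by linarith [hu'.1])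
      (hLne u hu'.1.le hu'.2.2.le hne)
  set S : Finset ℂ := {-(θ : ℂ), u₁} with hSdef
  have hS : (S : Set ℂ) ⊆ Ioo (-η) 1 ×ℂ Ioo (-T') T' := by
    intro p hp
    rw [hSdef, Finset.coe_insert, Finset.coe_singleton, Set.mem_insert_iff, Set.mem_singleton_iff] at hp
    rw [mem_reProdIm, mem_Ioo, mem_Ioo]
    rcases hp with rfl | rfl
    · simp only [neg_re, ofReal_re, neg_im, ofReal_im, neg_zero]
      refine ⟨⟨by linarith, by linarith⟩, by linarith, by linarith⟩
    · rw [hu₁re, hu₁im]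
      refine ⟨⟨by linarith, by linarith⟩, by linarith, hTβ⟩
  have hΦon : DifferentiableOn ℂ Φ (Uo \ ↑S) := by
    intro u hu
    have hu₁' : u ≠ u₁ := fun h => hu.2 (by rw [h, hSdef]; simp)
    exact (hΦdiff u hu.1 hu₁').differentiableWithinAt
  have hG : DifferentiableOn ℂ (fun s => Φ s *
      ((Y : ℂ) ^ (s + (θ : ℂ)) * omega1 Λ (s + (θ : ℂ)) / (s + (θ : ℂ)))) (Uo \ ↑S) :=
    differentiableOn_mul_kernel_sdiff hY Λ (by rw [hSdef]; simp) hΦon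
  -- the three bounds on `Φ`
  have hU32 : ∀ w : ℂ, 1 + 1 / 2 ≤ w.re → ‖U w‖ ≤ MU := fun w hw => hU w (by linarith)
  have hΦ₀ : ∀ t : ℝ, T' ≤ |t| → ‖Φ (((1 : ℝ) : ℂ) + t * I)‖ ≤ MU * ((1 + 1 / 2) / (1 / 2)) ^ 3 := by
    intro t _
    exact (norm_Phi_right_le χ U Φ βμ βa βb (α := 1 / 2) (by norm_num) hβμ hβa hβb hΦ hMU hU32
      (u := ((1 : ℝ) : ℂ) + t * I) (by simp; norm_num)).2
  have hΦ₁ : ∀ t : ℝ, |t| ≤ T' → ‖Φ (((-η : ℝ) : ℂ) + t * I)‖ ≤ MU * BL * BL * (Minv * (1 + 2 / η)) :=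
    fun t ht => norm_Phi_left_le χ U Φ βμ βa βb hη0 (by linarith) hβμ hβμn hβa hβa1 hβb hβb1 hΦ hMU hU
      hBL hL hMinv hpack hρη ht
  have hΦ₂ : ∀ u : ℝ, -η ≤ u → u ≤ 1 →
      ‖Φ ((u : ℂ) + (T' : ℂ) * I)‖ ≤ MU * BL * BL * (Minv * 3) ∧
        ‖Φ ((u : ℂ) + ((-T' : ℝ) : ℂ) * I)‖ ≤ MU * BL * BL * (Minv * 3) := by
    intro u h1 h2
    have hT0 : 0 ≤ T' := by linarith
    constructor
    · have := norm_Phi_horiz_le χ U Φ βμ βa βb (α := 1) hη0 (by linarith) le_rfl hT hβμ hβμn hβa hβa1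
        hβb hβb1 hΦ hMU hU hBL hL hMinv hpack h1 h2 (y := T') (abs_of_nonneg hT0)
      simpa using this
    · exact norm_Phi_horiz_le χ U Φ βμ βa βb (α := 1) hη0 (by linarith) le_rfl hT hβμ hβμn hβa hβa1
        hβb hβb1 hΦ hMU hU hBL hL hMinv hpack h1 h2 (y := -T') (by rw [abs_neg, abs_of_nonneg hT0])
  -- differentiability / continuity of `Φ` on the line `Re u = 1`
  have hΦdiff1 : ∀ t : ℝ, DifferentiableAt ℂ Φ (((1 : ℝ) : ℂ) + t * I) := by
    intro t
    have hne := (norm_Phi_right_le χ U Φ βμ βa βb (α := 1 / 2) (by norm_num) hβμ hβa hβb hΦ hMU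
      hU32 (u := ((1 : ℝ) : ℂ) + t * I) (by simp; norm_num)).1
    exact differentiableAt_Phi χ U Φ βμ βa βb hχ1 hUd hβμ hΦ (by simp; norm_num) hne
  have hcont : Continuous fun t : ℝ => Φ (((1 : ℝ) : ℂ) + t * I) := by
    have hline : Continuous fun t : ℝ => (((1 : ℝ) : ℂ) + t * I : ℂ) := by fun_prop
    exact continuous_iff_continuousAt.mpr fun t =>
      ContinuousAt.comp (f := fun t : ℝ => (((1 : ℝ) : ℂ) + t * I : ℂ)) (g := Φ) (x := t)
        (hΦdiff1 t).continuousAt hline.continuousAt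
  have h1θ : (1 : ℝ) + ((θ : ℂ)).re ≠ 0 := by rw [hβre]; linarith
  have hηθ : (-η : ℝ) + ((θ : ℂ)).re ≠ 0 := by rw [hβre]; linarith
  have hM₀0 : 0 ≤ MU * ((1 + 1 / 2) / (1 / 2)) ^ 3 := by positivity
  have hint : Integrable fun t : ℝ => Φ (((1 : ℝ) : ℂ) + t * I) *
      ((Y : ℂ) ^ ((((1 : ℝ) : ℂ) + t * I) + (θ : ℂ)) * omega1 Λ ((((1 : ℝ) : ℂ) + t * I) + (θ : ℂ)) /
        ((((1 : ℝ) : ℂ) + t * I) + (θ : ℂ))) :=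
    integrable_line (Φ := Φ) hΛ hY h1θ hcont (fun t => (norm_Phi_right_le χ U Φ βμ βa βb
      (α := 1 / 2) (by norm_num) hβμ hβa hβb hΦ hMU hU32 (u := ((1 : ℝ) : ℂ) + t * I) (by simp; norm_num)).2)
  -- the residue coefficient at `u₁`: `L(1−β_μ+u) = (u−u₁)ψ(u)`, `ψ(u₁) = L′(ρ̃) ≠ 0`
  have hLd := DirichletCharacter.differentiable_LFunction hχ1
  have hLw_diff : Differentiable ℂ (fun u : ℂ => χ.LFunction (1 - βμ + u)) :=
    fun u => (hLd _).comp u (differentiableAt_id.const_add _)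
  have hLw_u₁ : (fun u : ℂ => χ.LFunction (1 - βμ + u)) u₁ = 0 := by
    show χ.LFunction (1 - βμ + u₁) = 0
    rw [hw₁, hLρ]
  obtain ⟨ψ, hψ_diff, hψ_u₁', hfac⟩ :=
    exists_factor_of_zero' (fun u : ℂ => χ.LFunction (1 - βμ + u)) hLw_diff u₁ hLw_u₁
  have hψ_u₁ : ψ u₁ = deriv χ.LFunction ρ := by
    rw [hψ_u₁']
    have h2 : HasDerivAt (fun u : ℂ => 1 - βμ + u) 1 u₁ := (hasDerivAt_id u₁).const_add (1 - βμ)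
    have h1 : HasDerivAt χ.LFunction (deriv χ.LFunction ρ) (1 - βμ + u₁) := by
      rw [hw₁]; exact (hLd ρ).hasDerivAt
    have h := (h1.comp u₁ h2).deriv
    rw [mul_one] at h
    exact h
  have hψ_ne : ψ u₁ ≠ 0 := by rw [hψ_u₁]; exact hL'ρ
  set r : ℂ := U ρ * χ.LFunction (ρ + βa) * χ.LFunction (ρ + βb) / deriv χ.LFunction ρ with hrdef
  -- `(u − u₁)Φ(u) → r`
  have hnum_cont : ContinuousAt (fun u : ℂ => U (1 - βμ + u) * χ.LFunction (1 - βμ + u + βa) *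
      χ.LFunction (1 - βμ + u + βb) / ψ u) u₁ := by
    have hopen : IsOpen {s : ℂ | 9 / 10 < s.re} := isOpen_lt continuous_const Complex.continuous_re
    have hre : 9 / 10 < (1 - βμ + u₁).re := by rw [hw₁]; simp; linarith
    have hUc : ContinuousAt (fun u : ℂ => U (1 - βμ + u)) u₁ :=
      ((hUd.differentiableAt (hopen.mem_nhds hre)).comp u₁
        (differentiableAt_id.const_add _)).continuousAt
    have h1 : ContinuousAt (fun u : ℂ => χ.LFunction (1 - βμ + u + βa)) u₁ :=
      ((hLd _).comp u₁ (by fun_prop)).continuousAt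
    have h2 : ContinuousAt (fun u : ℂ => χ.LFunction (1 - βμ + u + βb)) u₁ :=
      ((hLd _).comp u₁ (by fun_prop)).continuousAt
    exact ((hUc.mul h1).mul h2).div (hψ_diff u₁).continuousAt hψ_ne
  have hlimΦ : Tendsto (fun z => (z - u₁) * Φ z) (𝓝[≠] u₁) (𝓝 r) := by
    have hval : U (1 - βμ + u₁) * χ.LFunction (1 - βμ + u₁ + βa) *
        χ.LFunction (1 - βμ + u₁ + βb) / ψ u₁ = r := by
      rw [hrdef, hw₁, hψ_u₁]
    rw [← hval]
    refine (hnum_cont.tendsto.mono_left nhdsWithin_le_nhds).congr' ?_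
    filter_upwards [self_mem_nhdsWithin] with z hz
    have hz' : z - u₁ ≠ 0 := sub_ne_zero.mpr hz
    rw [hΦ z, hfac z]
    field_simp
  -- the two punctured limits of `(z − p)·Φ(z)K(z)`
  have hlim : ∀ p ∈ S, ∃ r' : ℂ, Tendsto (fun z => (z - p) * (Φ z *
      ((Y : ℂ) ^ (z + (θ : ℂ)) * omega1 Λ (z + (θ : ℂ)) / (z + (θ : ℂ))))) (𝓝[≠] p) (𝓝 r') := by
    intro p hp
    rw [hSdef, Finset.mem_insert, Finset.mem_singleton] at hp
    rcases hp with rfl | rfl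
    · refine ⟨Φ (-(θ : ℂ)), ?_⟩
      have hc : ContinuousAt Φ (-(θ : ℂ)) := by
        refine (hΦdiff (-(θ : ℂ)) ?_ hneq).continuousAt
        refine ⟨?_, ?_, ?_⟩ <;> simp <;> linarith
      exact tendsto_sub_mul_kernel_at_neg hY Λ hc
    · exact ⟨_, tendsto_sub_mul_kernel_of_tendsto hY Λ hu₁θ hlimΦ⟩
  -- the Landau rectangle
  have hmain := norm_lineIntegral_sub_sum_limUnder_le (Φ := Φ) (β := (θ : ℂ)) (Λ := Λ) (Y := Y)
    hΛ hY (a := -η) (σ₀ := 1) (H := T') (by linarith) (by rw [hβim, abs_zero]; linarith) hηθ h1θ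
    hM₀0 (by positivity) (by positivity) hΦ₀ hΦ₁ hΦ₂ hint S Uo hUo_open hKU hS hG hlim
  -- the residues as `limUnder`s
  have hres : ∑ p ∈ S, limUnder (𝓝[≠] p) (fun z => (z - p) * (Φ z *
      ((Y : ℂ) ^ (z + (θ : ℂ)) * omega1 Λ (z + (θ : ℂ)) / (z + (θ : ℂ))))) =
      Φ (-(θ : ℂ)) + r * ((Y : ℂ) ^ (u₁ + (θ : ℂ)) * omega1 Λ (u₁ + (θ : ℂ)) / (u₁ + (θ : ℂ))) := by
    rw [hSdef, Finset.sum_insert (by rw [Finset.mem_singleton]; exact hneq), Finset.sum_singleton]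
    have hc : ContinuousAt Φ (-(θ : ℂ)) := by
      refine (hΦdiff (-(θ : ℂ)) ?_ hneq).continuousAt
      refine ⟨?_, ?_, ?_⟩ <;> simp <;> linarith
    rw [(tendsto_sub_mul_kernel_at_neg hY Λ hc).limUnder_eq,
      (tendsto_sub_mul_kernel_of_tendsto hY Λ hu₁θ hlimΦ).limUnder_eq]
  -- the Perron identity: the smoothed series is the line integral
  have hperron : (1 / (2 * π) : ℂ) * ∫ t : ℝ, Φ (((1 : ℝ) : ℂ) + t * I) *
      ((Y : ℂ) ^ ((((1 : ℝ) : ℂ) + t * I) + (θ : ℂ)) * omega1 Λ ((((1 : ℝ) : ℂ) + t * I) + (θ : ℂ)) /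
        ((((1 : ℝ) : ℂ) + t * I) + (θ : ℂ))) =
      ∑' n : ℕ, LSeries.term f (1 - βμ - θ) n * (gWeight Λ (Y / n) : ℂ) := by
    have hc0 : 0 < 1 + θ := by linarith
    have h := integral_LSeries_mul_kernel (Λ := Λ) (c := 1 + θ) hΛ hc0 hY (a := f)
      (s := 1 - βμ - θ) (by
        have : 1 - βμ - (θ : ℂ) + ((1 + θ : ℝ) : ℂ) = 2 - βμ := by push_cast; ring
        rw [this]; exact hfs)
    rw [← h]
    congr 1
    refine integral_congr_ae (Eventually.of_forall fun t => ?_)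
    have e1 : 1 - βμ - (θ : ℂ) + (((1 + θ : ℝ) : ℂ) + t * I) = 1 - βμ + (((1 : ℝ) : ℂ) + t * I) := by
      push_cast; ring
    have e2 : (((1 + θ : ℝ) : ℂ) + t * I) = (((1 : ℝ) : ℂ) + t * I) + (θ : ℂ) := by push_cast; ring
    simp only [kernel]
    rw [e1, hfΦ t, e2]
  rw [← hperron, ← hu₁, hrdef] at *
  rw [hres] at hmain
  simpa only [hβre, hβim, abs_zero, sub_zero] using hmain

end Contour

end Literature.NumberTheory.LFunctions.Zhang2022.Lemma84
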